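import Summits.ResolutionOfSingularities.ResolutionOfSingularities.Theorems.FrobeniusLadderFInjectiveMacaulayficationCICertificates
import Summits.ResolutionOfSingularities.ResolutionOfSingularities.Theorems.FrobeniusLadderFInjectiveMacaulayficationLevelTwoBlockTranslate
import Summits.ResolutionOfSingularities.ResolutionOfSingularities.Theorems.FrobeniusLadderFInjectiveMacaulayficationT11Char3Level2
import Summits.ResolutionOfSingularities.ResolutionOfSingularities.Theorems.FrobeniusLadderFInjectiveMacaulayficationT11Char3Poly
import Summits.ResolutionOfSingularities.ResolutionOfSingularities.Theorems.FrobeniusLadderFInjectiveMacaulayficationKLocCellRange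
import Summits.ResolutionOfSingularities.ResolutionOfSingularities.Theorems.FrobeniusLadderFInjectiveMacaulayficationNotDvdOfSupport
import Summits.ResolutionOfSingularities.ResolutionOfSingularities.Theorems.FrobeniusLadderFInjectiveMacaulayficationCIPolyKit
import Mathlib.Algebra.MvPolynomial.NoZeroDivisors
import HarnessLib

/-!
# E7 — THE LEVEL-2 CERTIFICATE BLOCKS of the T₁₁/3 instance (hon charts 64 and 66): the `hblock64` / `hblock66` inputs of
# `T11Char3Frame.t11_originPointFixable_char3_of_data`, DISCHARGED
# (crux `FInjectiveMacaulayfication` stmt-ResolutionOfSingularities-15315, chain w45a; E7 LEVEL-2 BINDER SHAPE, STATUS 2026-08-27T13:01:47Z)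

[OURS · L1 W4.5a · res-L1-w45a-lead-1 gen 5] Support file (`--supports stmt-ResolutionOfSingularities-15315 --as helper`); NOT a statement of
any manuscript; AI-written, weaker than expert review.

Per hon chart `σ ∈ {64, 66}`: (1) `block_of_fan` (= res-L1-w45a-stub-3's `CICertificates.ciCertificates` with (NZ) as a hypothesis) on the
TRANSLATED model `k[u]/(f̃_σ)` with the line-blow-up fan `LineBlowupFan4.Fan023` / `Fan012` (lead-1) and res-L1-w45a-stub-4's level-2
data `T11Char3Level2.{hθF₆₄/₆₆, hcov₆₄/₆₆, cells2, hX2, hg02}` (kernel cells through `KLocCellRange.honQuot_of_kLocCells_range`);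
(NZ) from `f̃_σ ∤ u_j` (§1: a non-constant, non-linear monomial with a unit coefficient); (2) `LevelTwoBlockTranslate.block_of_translated`
along the unit translation `τ : u_r ↦ y_r + 1` (res-type-034's N3 `TranslatedRelativeCN.exists_translate_algEquiv`; `τ f̃_σ = g_σ` is
stub-4's `T11Char3Level2.htrans`); (3) `TwoLevelRoadFrame.block_of_eq` with the centre equality
`span {mk (τ u^b) : b ∈ A} = (span {y₀, y₂, y₃+1})·(k[y]/(g₆₄))` (stub-4's `span_A_eq₀/₁`). OUTPUT: `hblock64`, `hblock66` in the EXACT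
binder shape of the T₁₁/3 frame. No definitions, no named facts. [folklore glue; cite: Fedder1983, Prop. 1.7 and Thm. 1.12]
-/

-- single-problem summit: the doubled namespace component is forced
set_option linter.dupNamespace false

noncomputable section

open AlgebraicGeometry CategoryTheory Literature.AlgebraicGeometry.Resolution MvPolynomial

namespace Summit.ResolutionOfSingularities.ResolutionOfSingularities.Theorems.FInjectiveMacaulayfication.T11Char3Level2Block

open Summit.ResolutionOfSingularities.ResolutionOfSingularities.Theorems.FInjectiveMacaulayfication

/-! ## §1 A term-list polynomial with a unit coefficient at a monomial of degree ≥ 2 divides no variable -/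

/-- If the term list `L` has, at an exponent `v` which is neither `0` nor a unit vector, an integer coefficient sum not divisible by the
characteristic `p`, then its value divides no variable `u_i` (a divisor of `u_i` is a unit or a unit multiple of `u_i`,
`MvPolynomial.dvd_X_iff_exists`, and both have zero coefficient at `v`). [folklore] -/
theorem not_dvd_X_evalL {K : Type} [Field K] {n : ℕ} (p : ℕ) [CharP K p] (L : List (ℤ × (Fin n → ℕ))) (v : Fin n → ℕ)
    (hv0 : v ≠ 0) (hv1 : ∀ i : Fin n, v ≠ Pi.single i 1)
    (hcoef : ¬ ((p : ℤ) ∣ ((L.filter fun t : ℤ × (Fin n → ℕ) => t.2 = v).map fun t : ℤ × (Fin n → ℕ) => t.1).sum)) :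
    ∀ i : Fin n, ¬ (KLocCellKit.evalL K L ∣ (X i : MvPolynomial (Fin n) K)) := by
  intro i h
  have hc : coeff (Finsupp.equivFunOnFinite.symm v) (KLocCellKit.evalL K L) ≠ 0 := by
    unfold KLocCellKit.evalL
    rw [CIPolyKit.coeff_evalL]
    exact fun h0 => hcoef ((CharP.intCast_eq_zero_iff K p _).mp h0)
  have hv0' : (Finsupp.equivFunOnFinite.symm v : Fin n →₀ ℕ) ≠ 0 := by
    intro h0
    apply hv0
    funext j
    have := DFunLike.congr_fun h0 j
    simpa using this
  have hv1' : ∀ i : Fin n, Finsupp.single i 1 ≠ (Finsupp.equivFunOnFinite.symm v : Fin n →₀ ℕ) := by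
    intro i h1
    apply hv1 i
    funext j
    have hj := DFunLike.congr_fun h1 j
    rw [Finsupp.single_eq_pi_single, Finsupp.coe_equivFunOnFinite_symm] at hj
    exact hj.symm
  obtain ⟨r, -, h1 | h2⟩ := MvPolynomial.dvd_X_iff_exists.mp h
  · rw [h1, coeff_C, if_neg (Ne.symm hv0')] at hc
    exact hc rfl
  · rw [h2, smul_eq_C_mul, coeff_C_mul, coeff_X, if_neg (hv1' i), mul_zero] at hc
    exact hc rfl

/-! ## §2 The certificate block from fan data and kernel cells, (NZ) as a hypothesis -/

section Fan

variable (p : ℕ) {n : ℕ} (k : Type) [Field k]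

/-- **A certificate block (COV) ∧ (NZ) ∧ (HON) from fan data and kernel cells, WITHOUT primality of the base** —
`CICertificates.ciCertificates` verbatim (res-L1-w45a-stub-3) except that (NZ) `x̄^(m c) ≠ 0` is taken as the hypothesis `hNZ`
instead of being derived from `(Fs)` prime (the level-2 bases `k[u]/(f̃_σ)` are domains, but we do not need to prove it: `f̃_σ ∤ u_j`
suffices, §1). [folklore] -/
theorem block_of_fan (J : Finset (Fin n))
    (A : Finset (Fin n →₀ ℕ)) (hprim : ∀ j ∈ J, ∃ N : ℕ, Finsupp.single j N ∈ A)
    (t : ℕ) (m : Fin t → (Fin n →₀ ℕ))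
    (hcov : ∀ a ∈ A, ∃ (c : Fin t) (K : ℕ), 1 ≤ K ∧ ∃ y ∈ (Ideal.span ((fun b : Fin n →₀ ℕ => (MvPolynomial.monomial b (1 : k) : MvPolynomial (Fin n) k)) '' (A : Set (Fin n →₀ ℕ)))) ^ (K - 1),
      (MvPolynomial.monomial a (1 : k) : MvPolynomial (Fin n) k) ^ K = MvPolynomial.monomial (m c) 1 * y)
    (V : Fin t → Matrix (Fin n) (Fin n) ℕ) (hV : ∀ c, IsUnit ((V c).map (Nat.cast : ℕ → ℤ)).det)
    (a : Fin t → Fin n → (Fin n →₀ ℕ)) (haA : ∀ c i, a c i ∈ A)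
    (hgen : ∀ (c : Fin t) (i : Fin n), (Finsupp.equivFunOnFinite.symm ((V c).mulVec ⇑(a c i)) : Fin n →₀ ℕ) =
      Finsupp.equivFunOnFinite.symm ((V c).mulVec ⇑(m c)) + Finsupp.single i 1)
    (hge : ∀ (c : Fin t), ∀ e ∈ A, (Finsupp.equivFunOnFinite.symm ((V c).mulVec ⇑(m c)) : Fin n →₀ ℕ) ≤
      Finsupp.equivFunOnFinite.symm ((V c).mulVec ⇑e))
    {r : ℕ} (Fs : Fin r → MvPolynomial (Fin n) k)
    (hNZ : ∀ c : Fin t, Ideal.Quotient.mk (Ideal.span (Set.range Fs)) (monomial (m c) (1 : k)) ≠ 0)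
    (gs : Fin t → Fin r → MvPolynomial (Fin n) k) (d : Fin t → Fin r → (Fin n →₀ ℕ))
    (hθF : ∀ (c : Fin t) (l : Fin r), aeval (fun j : Fin n => ∏ i : Fin n, (X i : MvPolynomial (Fin n) k) ^ V c i j) (Fs l) =
      monomial (d c l) (1 : k) * gs c l)
    (hunit : ∀ (c : Fin t) (l : Fin r), ∃ (N : ℕ) (r' : Fin n →₀ ℕ), N • m c = ∑ j : Fin n, d c l j • a c j + r')
    (hon' : ∀ (c : Fin t) (Q' : Ideal (MvPolynomial (Fin n) k ⧸ Ideal.span (Set.range (gs c)))) [Q'.IsMaximal],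
      (∀ j ∈ J, Ideal.Quotient.mk (Ideal.span (Set.range (gs c)))
        (aeval (fun j : Fin n => ∏ i : Fin n, (X i : MvPolynomial (Fin n) k) ^ V c i j) (X j : MvPolynomial (Fin n) k)) ∈ Q') →
        (∀ i : Fin n, (X i : MvPolynomial (Fin n) k) ∈ Q'.comap (Ideal.Quotient.mk (Ideal.span (Set.range (gs c)))) →
          IsSMulRegular (Localization.AtPrime (Q'.comap (Ideal.Quotient.mk (Ideal.span (Set.range (gs c))))) ⧸
              (Ideal.span (Set.range (gs c))).map (algebraMap (MvPolynomial (Fin n) k)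
                (Localization.AtPrime (Q'.comap (Ideal.Quotient.mk (Ideal.span (Set.range (gs c))))))))
            (algebraMap (MvPolynomial (Fin n) k)
              (Localization.AtPrime (Q'.comap (Ideal.Quotient.mk (Ideal.span (Set.range (gs c)))))) (X i))) ∧
        ∀ dd : ℕ, ringKrullDim (Localization.AtPrime Q') = dd → ∀ s : Fin dd → Localization.AtPrime Q',
          (Ideal.span (Set.range s)).radical.IsMaximal →
            RingTheory.Sequence.IsWeaklyRegular (Localization.AtPrime Q') (List.ofFn s) ∧
            ∀ y : Localization.AtPrime Q', (∃ e : ℕ, y ^ p ^ e ∈ Ideal.span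
              ((fun z : Localization.AtPrime Q' => z ^ p ^ e) ''
                (Ideal.span (Set.range s) : Set (Localization.AtPrime Q')))) → y ∈ Ideal.span (Set.range s))
    (hv : ∀ c : Fin t, Ideal.Quotient.mk (Ideal.span (Set.range Fs)) (monomial (m c) (1 : k)) ∈ (Ideal.span ((fun e : Fin n →₀ ℕ => Ideal.Quotient.mk (Ideal.span (Set.range Fs)) (monomial e (1 : k))) '' (A : Set (Fin n →₀ ℕ))))) :
    (HomogeneousIdeal.irrelevant (reesGrading (Ideal.span ((fun e : Fin n →₀ ℕ => Ideal.Quotient.mk (Ideal.span (Set.range Fs)) (monomial e (1 : k))) '' (A : Set (Fin n →₀ ℕ)))))).toIdeal ≤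
        (Ideal.span (Set.range fun c : Fin t => reesT (I := (Ideal.span ((fun e : Fin n →₀ ℕ => Ideal.Quotient.mk (Ideal.span (Set.range Fs)) (monomial e (1 : k))) '' (A : Set (Fin n →₀ ℕ)))))
          (Ideal.Quotient.mk (Ideal.span (Set.range Fs)) (monomial (m c) (1 : k))) (hv c))).radical ∧
      (∀ c : Fin t, Ideal.Quotient.mk (Ideal.span (Set.range Fs)) (monomial (m c) (1 : k)) ≠ 0) ∧
      ∀ (c : Fin t) (Q : Ideal ↥(blowupAlgebra (Ideal.span ((fun e : Fin n →₀ ℕ => Ideal.Quotient.mk (Ideal.span (Set.range Fs)) (monomial e (1 : k))) '' (A : Set (Fin n →₀ ℕ)))) (Ideal.Quotient.mk (Ideal.span (Set.range Fs)) (monomial (m c) (1 : k))))) [Q.IsMaximal],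
        algebraMap (MvPolynomial (Fin n) k ⧸ Ideal.span (Set.range Fs)) ↥(blowupAlgebra (Ideal.span ((fun e : Fin n →₀ ℕ => Ideal.Quotient.mk (Ideal.span (Set.range Fs)) (monomial e (1 : k))) '' (A : Set (Fin n →₀ ℕ)))) (Ideal.Quotient.mk (Ideal.span (Set.range Fs)) (monomial (m c) (1 : k)))) (Ideal.Quotient.mk (Ideal.span (Set.range Fs)) (monomial (m c) (1 : k))) ∈ Q →
        ∀ dd : ℕ, ringKrullDim (Localization.AtPrime Q) = dd → ∀ s : Fin dd → Localization.AtPrime Q,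
          (Ideal.span (Set.range s)).radical.IsMaximal →
            RingTheory.Sequence.IsWeaklyRegular (Localization.AtPrime Q) (List.ofFn s) ∧
            ∀ y : Localization.AtPrime Q, (∃ e : ℕ, y ^ p ^ e ∈ Ideal.span
              ((fun z : Localization.AtPrime Q => z ^ p ^ e) ''
                (Ideal.span (Set.range s) : Set (Localization.AtPrime Q)))) → y ∈ Ideal.span (Set.range s) := by
  refine ⟨?_, hNZ, fun c Q _ hu => ?_⟩
  · -- THE COVER, read off the identities `(x^a)^K = x^(m c) · y`
    have hImap : (Ideal.span ((fun e : Fin n →₀ ℕ => Ideal.Quotient.mk (Ideal.span (Set.range Fs)) (monomial e (1 : k))) '' (A : Set (Fin n →₀ ℕ)))) =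
        (Ideal.span ((fun b : Fin n →₀ ℕ => (MvPolynomial.monomial b (1 : k) : MvPolynomial (Fin n) k)) '' (A : Set (Fin n →₀ ℕ)))).map
          (Ideal.Quotient.mk (Ideal.span (Set.range Fs))) := by
      rw [Ideal.map_span, Set.image_image]
    refine ReesCoverOfPowers.stub_reesCoverOfPowers _ _ (Ideal.Quotient.mk (Ideal.span (Set.range Fs)) '' ((fun b : Fin n →₀ ℕ =>
      (MvPolynomial.monomial b (1 : k) : MvPolynomial (Fin n) k)) '' (A : Set (Fin n →₀ ℕ)))) (by rw [hImap, Ideal.map_span]) t _ hv ?_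
    rintro _ ⟨_, ⟨a', ha', rfl⟩, rfl⟩
    obtain ⟨c, K, hK, y, hy, hEq⟩ := hcov a' ha'
    refine ⟨c, K, hK, Ideal.Quotient.mk (Ideal.span (Set.range Fs)) y, ?_, ?_⟩
    · rw [hImap, ← Ideal.map_pow]
      exact Ideal.mem_map_of_mem _ hy
    · rw [← map_pow, hEq, map_mul]
  · exact CIConeFiModel.chartClause_of_quotientChartClause p (V c) (hV c) (m c) (a c) (hgen c) A (haA c) (hge c) J hprim Fs (gs c)
      (d c) (hθF c) (hunit c) (hon' c) Q hu




end Fan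

/-! ## §3 Chart 64: the translated model `k[u]/(f̃₆₄)`, its block, and the transport to `k[y]/(g₆₄)` -/

/-- `f̃₆₄ ∤ u_i`: the term `u₀²` of `f̃₆₄` has coefficient `1`. [table check + §1] -/
theorem ft64_not_dvd_X (k : Type) [Field k] [CharP k 3] :
    ∀ i : Fin 4, ¬ ((KLocCellKit.evalL k (T11Char3Level2.Ft 0)) ∣ (X i : MvPolynomial (Fin 4) k)) :=
  not_dvd_X_evalL 3 (T11Char3Level2.Ft 0) ![2, 0, 0, 0] (by decide) (by decide) (by decide +kernel)

/-- The vertex monomials `u_(jc c)` of `Fan023` are the variables. [table] -/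
theorem monomial_m₀ (k : Type) [Field k] (c : Fin 3) :
    (monomial (LineBlowupFan4.Fan023.m c) (1 : k) : MvPolynomial (Fin 4) k) = X (LineBlowupFan4.Fan023.jc c) := by
  have h : LineBlowupFan4.Fan023.m c = Finsupp.single (LineBlowupFan4.Fan023.jc c) 1 := by
    ext j
    rw [Finsupp.single_apply]
    fin_cases c <;> fin_cases j <;> rfl
  rw [h, ← X_pow_eq_monomial, pow_one]

/-- (NZ) for chart 64: `ū_(jc c) ≠ 0` in `k[u]/(f̃₆₄)`. -/
theorem hNZ₀ (k : Type) [Field k] [CharP k 3] : ∀ c : Fin 3,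
    Ideal.Quotient.mk (Ideal.span (Set.range (![(KLocCellKit.evalL k (T11Char3Level2.Ft 0))] : Fin 1 → MvPolynomial (Fin 4) k))) (monomial (LineBlowupFan4.Fan023.m c) (1 : k)) ≠ 0 := by
  intro c h
  rw [Ideal.Quotient.eq_zero_iff_mem, LevelTwoBlockTranslate.range_vec_one, Ideal.mem_span_singleton, monomial_m₀] at h
  exact ft64_not_dvd_X k _ h

/-- **The LEVEL-2 certificate block on the translated model of chart 64** (`block_of_fan` on `Fan023` + stub-4's level-2 data). -/
theorem block₀ (k : Type) [Field k] [CharP k 3] :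
    ∃ (t₂ : ℕ) (w₂ : Fin t₂ → (MvPolynomial (Fin 4) k ⧸ Ideal.span (Set.range (![(KLocCellKit.evalL k (T11Char3Level2.Ft 0))] : Fin 1 → MvPolynomial (Fin 4) k)))) (hw₂ : ∀ j : Fin t₂, w₂ j ∈ (Ideal.span ((fun e : Fin 4 →₀ ℕ => Ideal.Quotient.mk (Ideal.span (Set.range (![(KLocCellKit.evalL k (T11Char3Level2.Ft 0))] : Fin 1 → MvPolynomial (Fin 4) k))) (monomial e (1 : k))) '' (LineBlowupFan4.Fan023.A : Set (Fin 4 →₀ ℕ))))),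
        (HomogeneousIdeal.irrelevant (reesGrading (Ideal.span ((fun e : Fin 4 →₀ ℕ => Ideal.Quotient.mk (Ideal.span (Set.range (![(KLocCellKit.evalL k (T11Char3Level2.Ft 0))] : Fin 1 → MvPolynomial (Fin 4) k))) (monomial e (1 : k))) '' (LineBlowupFan4.Fan023.A : Set (Fin 4 →₀ ℕ)))))).toIdeal ≤
          (Ideal.span (Set.range fun j : Fin t₂ => reesT (I := (Ideal.span ((fun e : Fin 4 →₀ ℕ => Ideal.Quotient.mk (Ideal.span (Set.range (![(KLocCellKit.evalL k (T11Char3Level2.Ft 0))] : Fin 1 → MvPolynomial (Fin 4) k))) (monomial e (1 : k))) '' (LineBlowupFan4.Fan023.A : Set (Fin 4 →₀ ℕ))))) (w₂ j) (hw₂ j))).radical ∧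
        (∀ j : Fin t₂, w₂ j ≠ 0) ∧
        ∀ (j : Fin t₂) (Q : Ideal (blowupAlgebra (Ideal.span ((fun e : Fin 4 →₀ ℕ => Ideal.Quotient.mk (Ideal.span (Set.range (![(KLocCellKit.evalL k (T11Char3Level2.Ft 0))] : Fin 1 → MvPolynomial (Fin 4) k))) (monomial e (1 : k))) '' (LineBlowupFan4.Fan023.A : Set (Fin 4 →₀ ℕ)))) (w₂ j))) [Q.IsMaximal],
          algebraMap (MvPolynomial (Fin 4) k ⧸ Ideal.span (Set.range (![(KLocCellKit.evalL k (T11Char3Level2.Ft 0))] : Fin 1 → MvPolynomial (Fin 4) k))) (blowupAlgebra (Ideal.span ((fun e : Fin 4 →₀ ℕ => Ideal.Quotient.mk (Ideal.span (Set.range (![(KLocCellKit.evalL k (T11Char3Level2.Ft 0))] : Fin 1 → MvPolynomial (Fin 4) k))) (monomial e (1 : k))) '' (LineBlowupFan4.Fan023.A : Set (Fin 4 →₀ ℕ)))) (w₂ j)) (w₂ j) ∈ Q →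
          ∀ dd : ℕ, ringKrullDim (Localization.AtPrime Q) = dd → ∀ s : Fin dd → Localization.AtPrime Q,
          (Ideal.span (Set.range s)).radical.IsMaximal →
            RingTheory.Sequence.IsWeaklyRegular (Localization.AtPrime Q) (List.ofFn s) ∧
            ∀ y : Localization.AtPrime Q, (∃ e : ℕ, y ^ 3 ^ e ∈ Ideal.span
              ((fun z : Localization.AtPrime Q => z ^ 3 ^ e) ''
                (Ideal.span (Set.range s) : Set (Localization.AtPrime Q)))) → y ∈ Ideal.span (Set.range s) := by
  haveI : Fact (Nat.Prime 3) := ⟨Nat.prime_three⟩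
  refine ⟨3, fun c => Ideal.Quotient.mk (Ideal.span (Set.range (![(KLocCellKit.evalL k (T11Char3Level2.Ft 0))] : Fin 1 → MvPolynomial (Fin 4) k))) (monomial (LineBlowupFan4.Fan023.m c) (1 : k)), LineBlowupFan4.Fan023.hzero k _, ?_⟩
  exact block_of_fan 3 k LineBlowupFan4.Fan023.J LineBlowupFan4.Fan023.A LineBlowupFan4.Fan023.hprim 3 LineBlowupFan4.Fan023.m
    (LineBlowupFan4.Fan023.hcov k) LineBlowupFan4.Fan023.V LineBlowupFan4.Fan023.hV LineBlowupFan4.Fan023.a LineBlowupFan4.Fan023.haA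
    LineBlowupFan4.Fan023.hgen LineBlowupFan4.Fan023.hge (![(KLocCellKit.evalL k (T11Char3Level2.Ft 0))] : Fin 1 → MvPolynomial (Fin 4) k) (hNZ₀ k)
    (fun c => (![KLocCellKit.evalL k (T11Char3Level2.G2 0 c)] : Fin 1 → MvPolynomial (Fin 4) k))
    (fun c _ => Finsupp.single (LineBlowupFan4.Fan023.jc c) 2) (T11Char3Level2.hθF₆₄ k)
    (LineBlowupFan4.Fan023.hunit (fun _ => 2) _ (fun c => rfl))
    (fun c => KLocCellRange.honQuot_of_kLocCells_range 3 k 4 LineBlowupFan4.Fan023.J (LineBlowupFan4.Fan023.V c)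
      (![KLocCellKit.evalL k (T11Char3Level2.G2 0 c)] : Fin 1 → MvPolynomial (Fin 4) k) (T11Char3Level2.hg02 k 0 c) (T11Char3Level2.hX2 k 0 c)
      (T11Char3Level2.SS2 0 c) (T11Char3Level2.hcov₆₄ c) (T11Char3Level2.cells2 k 0 c))
    (LineBlowupFan4.Fan023.hzero k _)

/-- `T11Char3Poly.HS 64` as a literal. [table check] -/
theorem HS64_eq : T11Char3Poly.HS 64 = [[((1 : ℤ), (![1, 0, 0, 0] : Fin 4 → ℕ))], [((1 : ℤ), (![0, 0, 1, 0] : Fin 4 → ℕ))],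
    [((1 : ℤ), (![0, 0, 0, 1] : Fin 4 → ℕ)), ((1 : ℤ), (![0, 0, 0, 0] : Fin 4 → ℕ))]] := by
  decide +kernel

/-- The model generators of the curve in chart 64: `(y₀, y₂, y₃ + 1)`. -/
theorem HS64_eval (k : Type) [Field k] :
    (T11Char3Poly.HS 64).map (KLocCellKit.evalL k) = [(X 0 : MvPolynomial (Fin 4) k), X 2, X 3 + 1] := by
  rw [HS64_eq]
  simp only [List.map_cons, List.map_nil, KLocCellKit.evalL, List.sum_cons, List.sum_nil, T11Char7Poly.monomial_four,
    Int.cast_one, map_one, one_mul, pow_zero, pow_one, mul_one, add_zero]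

/-- **`hblock64` — THE LEVEL-2 BLOCK OF CHART 64 in the binder shape of `T11Char3Frame.t11_originPointFixable_char3_of_data`.** -/
theorem hblock64 (k : Type) [Field k] [CharP k 3] :
    ∃ (t₂ : ℕ) (w₂ : Fin t₂ → (MvPolynomial (Fin 4) k ⧸ Ideal.span {(KLocCellKit.evalL k (T11Char7Poly.G 64))})) (hw₂ : ∀ j : Fin t₂, w₂ j ∈ ((Ideal.span {x | x ∈ (T11Char3Poly.HS 64).map (KLocCellKit.evalL k)}).map (Ideal.Quotient.mk (Ideal.span {(KLocCellKit.evalL k (T11Char7Poly.G 64))})))),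
        (HomogeneousIdeal.irrelevant (reesGrading ((Ideal.span {x | x ∈ (T11Char3Poly.HS 64).map (KLocCellKit.evalL k)}).map (Ideal.Quotient.mk (Ideal.span {(KLocCellKit.evalL k (T11Char7Poly.G 64))}))))).toIdeal ≤
          (Ideal.span (Set.range fun j : Fin t₂ => reesT (I := ((Ideal.span {x | x ∈ (T11Char3Poly.HS 64).map (KLocCellKit.evalL k)}).map (Ideal.Quotient.mk (Ideal.span {(KLocCellKit.evalL k (T11Char7Poly.G 64))})))) (w₂ j) (hw₂ j))).radical ∧
        (∀ j : Fin t₂, w₂ j ≠ 0) ∧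
        ∀ (j : Fin t₂) (Q : Ideal (blowupAlgebra ((Ideal.span {x | x ∈ (T11Char3Poly.HS 64).map (KLocCellKit.evalL k)}).map (Ideal.Quotient.mk (Ideal.span {(KLocCellKit.evalL k (T11Char7Poly.G 64))}))) (w₂ j))) [Q.IsMaximal],
          algebraMap (MvPolynomial (Fin 4) k ⧸ Ideal.span {(KLocCellKit.evalL k (T11Char7Poly.G 64))}) (blowupAlgebra ((Ideal.span {x | x ∈ (T11Char3Poly.HS 64).map (KLocCellKit.evalL k)}).map (Ideal.Quotient.mk (Ideal.span {(KLocCellKit.evalL k (T11Char7Poly.G 64))}))) (w₂ j)) (w₂ j) ∈ Q →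
          ∀ dd : ℕ, ringKrullDim (Localization.AtPrime Q) = dd → ∀ s : Fin dd → Localization.AtPrime Q,
          (Ideal.span (Set.range s)).radical.IsMaximal →
            RingTheory.Sequence.IsWeaklyRegular (Localization.AtPrime Q) (List.ofFn s) ∧
            ∀ y : Localization.AtPrime Q, (∃ e : ℕ, y ^ 3 ^ e ∈ Ideal.span
              ((fun z : Localization.AtPrime Q => z ^ 3 ^ e) ''
                (Ideal.span (Set.range s) : Set (Localization.AtPrime Q)))) → y ∈ Ideal.span (Set.range s) := by
  classical
  obtain ⟨τ, hτr, hτi, -, -⟩ := TranslatedRelativeCN.exists_translate_algEquiv k 4 (3 : Fin 4) (1 : k)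
  have hg : τ.toRingEquiv (KLocCellKit.evalL k (T11Char3Level2.Ft 0)) = (KLocCellKit.evalL k (T11Char7Poly.G 64)) := by
    have h := T11Char3Level2.htrans k 0 τ.toAlgHom
      (by simpa [T11Char3Level2.trC] using hτr)
      (fun i hi => hτi i (by simpa [T11Char3Level2.trC] using hi))
    exact h
  have hb := LevelTwoBlockTranslate.block_of_translated 3 τ.toRingEquiv (KLocCellKit.evalL k (T11Char3Level2.Ft 0)) (KLocCellKit.evalL k (T11Char7Poly.G 64)) hg LineBlowupFan4.Fan023.A (block₀ k)
  refine TwoLevelRoadFrame.block_of_eq 3 ?_ hb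
  -- the centre: `span {mk (τ u^b) : b ∈ A} = (y₀, y₂, y₃ + 1) · k[y]/(g₆₄)`
  have hL : Ideal.span ((fun e : Fin 4 →₀ ℕ => Ideal.Quotient.mk (Ideal.span {(KLocCellKit.evalL k (T11Char7Poly.G 64))}) (τ.toRingEquiv (monomial e (1 : k)))) '' (LineBlowupFan4.Fan023.A : Set (Fin 4 →₀ ℕ))) =
      (Ideal.span ((fun j : Fin 4 => (X j : MvPolynomial (Fin 4) k)) '' (LineBlowupFan4.Fan023.J : Set (Fin 4)))).map
        ((Ideal.Quotient.mk (Ideal.span {(KLocCellKit.evalL k (T11Char7Poly.G 64))})).comp τ.toRingEquiv.toRingHom) := by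
    rw [← T11Char3Level2.span_A_eq₀ k, Ideal.map_span, Set.image_image]
    rfl
  rw [hL, Ideal.map_span, Ideal.map_span, Set.image_image]
  congr 1
  ext y
  simp only [Set.mem_image, Finset.mem_coe, LineBlowupFan4.Fan023.J, Finset.mem_insert, Finset.mem_singleton, Set.mem_setOf_eq,
    HS64_eval, List.mem_cons, List.mem_nil_iff, or_false, RingHom.coe_comp, Function.comp_apply]
  have h0 : τ.toRingEquiv.toRingHom (X 0) = X 0 := hτi 0 (by decide)
  have h2 : τ.toRingEquiv.toRingHom (X 2) = X 2 := hτi 2 (by decide)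
  have h3 : τ.toRingEquiv.toRingHom (X 3) = X 3 + 1 := by rw [show (1 : MvPolynomial (Fin 4) k) = C 1 from C_1.symm]; exact hτr
  constructor
  · rintro ⟨j, hj, rfl⟩
    rcases hj with rfl | rfl | rfl
    · exact ⟨X 0, Or.inl rfl, by rw [h0]⟩
    · exact ⟨X 2, Or.inr (Or.inl rfl), by rw [h2]⟩
    · exact ⟨X 3 + 1, Or.inr (Or.inr rfl), by rw [h3]⟩
  · rintro ⟨x, hx, rfl⟩
    rcases hx with rfl | rfl | rfl
    · exact ⟨0, Or.inl rfl, by rw [h0]⟩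
    · exact ⟨2, Or.inr (Or.inl rfl), by rw [h2]⟩
    · exact ⟨3, Or.inr (Or.inr rfl), by rw [h3]⟩

/-! ## §4 Chart 66: the translated model `k[u]/(f̃₆₆)`, its block, and the transport to `k[y]/(g₆₆)` -/

/-- `f̃₆₆ ∤ u_i`: the term `u₀²` of `f̃₆₆` has coefficient `1`. [table check + §1] -/
theorem ft66_not_dvd_X (k : Type) [Field k] [CharP k 3] :
    ∀ i : Fin 4, ¬ ((KLocCellKit.evalL k (T11Char3Level2.Ft 1)) ∣ (X i : MvPolynomial (Fin 4) k)) :=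
  not_dvd_X_evalL 3 (T11Char3Level2.Ft 1) ![2, 0, 0, 0] (by decide) (by decide) (by decide +kernel)

/-- The vertex monomials `u_(jc c)` of `Fan012` are the variables. [table] -/
theorem monomial_m₁ (k : Type) [Field k] (c : Fin 3) :
    (monomial (LineBlowupFan4.Fan012.m c) (1 : k) : MvPolynomial (Fin 4) k) = X (LineBlowupFan4.Fan012.jc c) := by
  have h : LineBlowupFan4.Fan012.m c = Finsupp.single (LineBlowupFan4.Fan012.jc c) 1 := by
    ext j
    rw [Finsupp.single_apply]
    fin_cases c <;> fin_cases j <;> rfl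
  rw [h, ← X_pow_eq_monomial, pow_one]

/-- (NZ) for chart 66: `ū_(jc c) ≠ 0` in `k[u]/(f̃₆₆)`. -/
theorem hNZ₁ (k : Type) [Field k] [CharP k 3] : ∀ c : Fin 3,
    Ideal.Quotient.mk (Ideal.span (Set.range (![(KLocCellKit.evalL k (T11Char3Level2.Ft 1))] : Fin 1 → MvPolynomial (Fin 4) k))) (monomial (LineBlowupFan4.Fan012.m c) (1 : k)) ≠ 0 := by
  intro c h
  rw [Ideal.Quotient.eq_zero_iff_mem, LevelTwoBlockTranslate.range_vec_one, Ideal.mem_span_singleton, monomial_m₁] at h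
  exact ft66_not_dvd_X k _ h

/-- **The LEVEL-2 certificate block on the translated model of chart 66** (`block_of_fan` on `Fan012` + stub-4's level-2 data). -/
theorem block₁ (k : Type) [Field k] [CharP k 3] :
    ∃ (t₂ : ℕ) (w₂ : Fin t₂ → (MvPolynomial (Fin 4) k ⧸ Ideal.span (Set.range (![(KLocCellKit.evalL k (T11Char3Level2.Ft 1))] : Fin 1 → MvPolynomial (Fin 4) k)))) (hw₂ : ∀ j : Fin t₂, w₂ j ∈ (Ideal.span ((fun e : Fin 4 →₀ ℕ => Ideal.Quotient.mk (Ideal.span (Set.range (![(KLocCellKit.evalL k (T11Char3Level2.Ft 1))] : Fin 1 → MvPolynomial (Fin 4) k))) (monomial e (1 : k))) '' (LineBlowupFan4.Fan012.A : Set (Fin 4 →₀ ℕ))))),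
        (HomogeneousIdeal.irrelevant (reesGrading (Ideal.span ((fun e : Fin 4 →₀ ℕ => Ideal.Quotient.mk (Ideal.span (Set.range (![(KLocCellKit.evalL k (T11Char3Level2.Ft 1))] : Fin 1 → MvPolynomial (Fin 4) k))) (monomial e (1 : k))) '' (LineBlowupFan4.Fan012.A : Set (Fin 4 →₀ ℕ)))))).toIdeal ≤
          (Ideal.span (Set.range fun j : Fin t₂ => reesT (I := (Ideal.span ((fun e : Fin 4 →₀ ℕ => Ideal.Quotient.mk (Ideal.span (Set.range (![(KLocCellKit.evalL k (T11Char3Level2.Ft 1))] : Fin 1 → MvPolynomial (Fin 4) k))) (monomial e (1 : k))) '' (LineBlowupFan4.Fan012.A : Set (Fin 4 →₀ ℕ))))) (w₂ j) (hw₂ j))).radical ∧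
        (∀ j : Fin t₂, w₂ j ≠ 0) ∧
        ∀ (j : Fin t₂) (Q : Ideal (blowupAlgebra (Ideal.span ((fun e : Fin 4 →₀ ℕ => Ideal.Quotient.mk (Ideal.span (Set.range (![(KLocCellKit.evalL k (T11Char3Level2.Ft 1))] : Fin 1 → MvPolynomial (Fin 4) k))) (monomial e (1 : k))) '' (LineBlowupFan4.Fan012.A : Set (Fin 4 →₀ ℕ)))) (w₂ j))) [Q.IsMaximal],
          algebraMap (MvPolynomial (Fin 4) k ⧸ Ideal.span (Set.range (![(KLocCellKit.evalL k (T11Char3Level2.Ft 1))] : Fin 1 → MvPolynomial (Fin 4) k))) (blowupAlgebra (Ideal.span ((fun e : Fin 4 →₀ ℕ => Ideal.Quotient.mk (Ideal.span (Set.range (![(KLocCellKit.evalL k (T11Char3Level2.Ft 1))] : Fin 1 → MvPolynomial (Fin 4) k))) (monomial e (1 : k))) '' (LineBlowupFan4.Fan012.A : Set (Fin 4 →₀ ℕ)))) (w₂ j)) (w₂ j) ∈ Q →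
          ∀ dd : ℕ, ringKrullDim (Localization.AtPrime Q) = dd → ∀ s : Fin dd → Localization.AtPrime Q,
          (Ideal.span (Set.range s)).radical.IsMaximal →
            RingTheory.Sequence.IsWeaklyRegular (Localization.AtPrime Q) (List.ofFn s) ∧
            ∀ y : Localization.AtPrime Q, (∃ e : ℕ, y ^ 3 ^ e ∈ Ideal.span
              ((fun z : Localization.AtPrime Q => z ^ 3 ^ e) ''
                (Ideal.span (Set.range s) : Set (Localization.AtPrime Q)))) → y ∈ Ideal.span (Set.range s) := by
  haveI : Fact (Nat.Prime 3) := ⟨Nat.prime_three⟩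
  refine ⟨3, fun c => Ideal.Quotient.mk (Ideal.span (Set.range (![(KLocCellKit.evalL k (T11Char3Level2.Ft 1))] : Fin 1 → MvPolynomial (Fin 4) k))) (monomial (LineBlowupFan4.Fan012.m c) (1 : k)), LineBlowupFan4.Fan012.hzero k _, ?_⟩
  exact block_of_fan 3 k LineBlowupFan4.Fan012.J LineBlowupFan4.Fan012.A LineBlowupFan4.Fan012.hprim 3 LineBlowupFan4.Fan012.m
    (LineBlowupFan4.Fan012.hcov k) LineBlowupFan4.Fan012.V LineBlowupFan4.Fan012.hV LineBlowupFan4.Fan012.a LineBlowupFan4.Fan012.haA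
    LineBlowupFan4.Fan012.hgen LineBlowupFan4.Fan012.hge (![(KLocCellKit.evalL k (T11Char3Level2.Ft 1))] : Fin 1 → MvPolynomial (Fin 4) k) (hNZ₁ k)
    (fun c => (![KLocCellKit.evalL k (T11Char3Level2.G2 1 c)] : Fin 1 → MvPolynomial (Fin 4) k))
    (fun c _ => Finsupp.single (LineBlowupFan4.Fan012.jc c) 2) (T11Char3Level2.hθF₆₆ k)
    (LineBlowupFan4.Fan012.hunit (fun _ => 2) _ (fun c => rfl))
    (fun c => KLocCellRange.honQuot_of_kLocCells_range 3 k 4 LineBlowupFan4.Fan012.J (LineBlowupFan4.Fan012.V c)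
      (![KLocCellKit.evalL k (T11Char3Level2.G2 1 c)] : Fin 1 → MvPolynomial (Fin 4) k) (T11Char3Level2.hg02 k 1 c) (T11Char3Level2.hX2 k 1 c)
      (T11Char3Level2.SS2 1 c) (T11Char3Level2.hcov₆₆ c) (T11Char3Level2.cells2 k 1 c))
    (LineBlowupFan4.Fan012.hzero k _)

/-- `T11Char3Poly.HS 66` as a literal. [table check] -/
theorem HS66_eq : T11Char3Poly.HS 66 = [[((1 : ℤ), (![1, 0, 0, 0] : Fin 4 → ℕ))], [((1 : ℤ), (![0, 1, 0, 0] : Fin 4 → ℕ))],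
    [((1 : ℤ), (![0, 0, 1, 0] : Fin 4 → ℕ)), ((1 : ℤ), (![0, 0, 0, 0] : Fin 4 → ℕ))]] := by
  decide +kernel

/-- The model generators of the curve in chart 66: `(y₀, y₁, y₂ + 1)`. -/
theorem HS66_eval (k : Type) [Field k] :
    (T11Char3Poly.HS 66).map (KLocCellKit.evalL k) = [(X 0 : MvPolynomial (Fin 4) k), X 1, X 2 + 1] := by
  rw [HS66_eq]
  simp only [List.map_cons, List.map_nil, KLocCellKit.evalL, List.sum_cons, List.sum_nil, T11Char7Poly.monomial_four,
    Int.cast_one, map_one, one_mul, pow_zero, pow_one, mul_one, add_zero]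

/-- **`hblock66` — THE LEVEL-2 BLOCK OF CHART 66 in the binder shape of `T11Char3Frame.t11_originPointFixable_char3_of_data`.** -/
theorem hblock66 (k : Type) [Field k] [CharP k 3] :
    ∃ (t₂ : ℕ) (w₂ : Fin t₂ → (MvPolynomial (Fin 4) k ⧸ Ideal.span {(KLocCellKit.evalL k (T11Char7Poly.G 66))})) (hw₂ : ∀ j : Fin t₂, w₂ j ∈ ((Ideal.span {x | x ∈ (T11Char3Poly.HS 66).map (KLocCellKit.evalL k)}).map (Ideal.Quotient.mk (Ideal.span {(KLocCellKit.evalL k (T11Char7Poly.G 66))})))),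
        (HomogeneousIdeal.irrelevant (reesGrading ((Ideal.span {x | x ∈ (T11Char3Poly.HS 66).map (KLocCellKit.evalL k)}).map (Ideal.Quotient.mk (Ideal.span {(KLocCellKit.evalL k (T11Char7Poly.G 66))}))))).toIdeal ≤
          (Ideal.span (Set.range fun j : Fin t₂ => reesT (I := ((Ideal.span {x | x ∈ (T11Char3Poly.HS 66).map (KLocCellKit.evalL k)}).map (Ideal.Quotient.mk (Ideal.span {(KLocCellKit.evalL k (T11Char7Poly.G 66))})))) (w₂ j) (hw₂ j))).radical ∧
        (∀ j : Fin t₂, w₂ j ≠ 0) ∧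
        ∀ (j : Fin t₂) (Q : Ideal (blowupAlgebra ((Ideal.span {x | x ∈ (T11Char3Poly.HS 66).map (KLocCellKit.evalL k)}).map (Ideal.Quotient.mk (Ideal.span {(KLocCellKit.evalL k (T11Char7Poly.G 66))}))) (w₂ j))) [Q.IsMaximal],
          algebraMap (MvPolynomial (Fin 4) k ⧸ Ideal.span {(KLocCellKit.evalL k (T11Char7Poly.G 66))}) (blowupAlgebra ((Ideal.span {x | x ∈ (T11Char3Poly.HS 66).map (KLocCellKit.evalL k)}).map (Ideal.Quotient.mk (Ideal.span {(KLocCellKit.evalL k (T11Char7Poly.G 66))}))) (w₂ j)) (w₂ j) ∈ Q →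
          ∀ dd : ℕ, ringKrullDim (Localization.AtPrime Q) = dd → ∀ s : Fin dd → Localization.AtPrime Q,
          (Ideal.span (Set.range s)).radical.IsMaximal →
            RingTheory.Sequence.IsWeaklyRegular (Localization.AtPrime Q) (List.ofFn s) ∧
            ∀ y : Localization.AtPrime Q, (∃ e : ℕ, y ^ 3 ^ e ∈ Ideal.span
              ((fun z : Localization.AtPrime Q => z ^ 3 ^ e) ''
                (Ideal.span (Set.range s) : Set (Localization.AtPrime Q)))) → y ∈ Ideal.span (Set.range s) := by
  classical
  obtain ⟨τ, hτr, hτi, -, -⟩ := TranslatedRelativeCN.exists_translate_algEquiv k 4 (2 : Fin 4) (1 : k)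
  have hg : τ.toRingEquiv (KLocCellKit.evalL k (T11Char3Level2.Ft 1)) = (KLocCellKit.evalL k (T11Char7Poly.G 66)) := by
    have h := T11Char3Level2.htrans k 1 τ.toAlgHom
      (by simpa [T11Char3Level2.trC] using hτr)
      (fun i hi => hτi i (by simpa [T11Char3Level2.trC] using hi))
    exact h
  have hb := LevelTwoBlockTranslate.block_of_translated 3 τ.toRingEquiv (KLocCellKit.evalL k (T11Char3Level2.Ft 1)) (KLocCellKit.evalL k (T11Char7Poly.G 66)) hg LineBlowupFan4.Fan012.A (block₁ k)
  refine TwoLevelRoadFrame.block_of_eq 3 ?_ hb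
  -- the centre: `span {mk (τ u^b) : b ∈ A} = (y₀, y₁, y₂ + 1) · k[y]/(g₆₆)`
  have hL : Ideal.span ((fun e : Fin 4 →₀ ℕ => Ideal.Quotient.mk (Ideal.span {(KLocCellKit.evalL k (T11Char7Poly.G 66))}) (τ.toRingEquiv (monomial e (1 : k)))) '' (LineBlowupFan4.Fan012.A : Set (Fin 4 →₀ ℕ))) =
      (Ideal.span ((fun j : Fin 4 => (X j : MvPolynomial (Fin 4) k)) '' (LineBlowupFan4.Fan012.J : Set (Fin 4)))).map
        ((Ideal.Quotient.mk (Ideal.span {(KLocCellKit.evalL k (T11Char7Poly.G 66))})).comp τ.toRingEquiv.toRingHom) := by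
    rw [← T11Char3Level2.span_A_eq₁ k, Ideal.map_span, Set.image_image]
    rfl
  rw [hL, Ideal.map_span, Ideal.map_span, Set.image_image]
  congr 1
  ext y
  simp only [Set.mem_image, Finset.mem_coe, LineBlowupFan4.Fan012.J, Finset.mem_insert, Finset.mem_singleton, Set.mem_setOf_eq,
    HS66_eval, List.mem_cons, List.mem_nil_iff, or_false, RingHom.coe_comp, Function.comp_apply]
  have h0 : τ.toRingEquiv.toRingHom (X 0) = X 0 := hτi 0 (by decide)
  have h1 : τ.toRingEquiv.toRingHom (X 1) = X 1 := hτi 1 (by decide)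
  have h2 : τ.toRingEquiv.toRingHom (X 2) = X 2 + 1 := by rw [show (1 : MvPolynomial (Fin 4) k) = C 1 from C_1.symm]; exact hτr
  constructor
  · rintro ⟨j, hj, rfl⟩
    rcases hj with rfl | rfl | rfl
    · exact ⟨X 0, Or.inl rfl, by rw [h0]⟩
    · exact ⟨X 1, Or.inr (Or.inl rfl), by rw [h1]⟩
    · exact ⟨X 2 + 1, Or.inr (Or.inr rfl), by rw [h2]⟩
  · rintro ⟨x, hx, rfl⟩
    rcases hx with rfl | rfl | rfl
    · exact ⟨0, Or.inl rfl, by rw [h0]⟩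
    · exact ⟨1, Or.inr (Or.inl rfl), by rw [h1]⟩
    · exact ⟨2, Or.inr (Or.inr rfl), by rw [h2]⟩

end Summit.ResolutionOfSingularities.ResolutionOfSingularities.Theorems.FInjectiveMacaulayfication.T11Char3Level2Block

end
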